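import Summits.QuantumFields.YangMills.Theorems.BalabanUVNodesN15KingModelGraphTreeDecayExtensive

/-!
# BalabanUVNodes ∕ N15 — THE KING-MODEL RUNG (PART Β-b): EXTENSIVITY FOR DIAGRAMS PAIRED WITH BOUNDED UNIT-LATTICE FIELDS — (3.40) ⇒ (3.42) ⇒ THE SHAPE
# `C·L^{−γk}·|T|` OF THEOREM 3.4 (3.9) FOR ONE DIAGRAM, BY NAME AT `A = 0`, AND THE HYPOTHESIS-FREE CLASS (connected pseudoforests of `G`-lines, `1 ≤ d ≤ 3`)
# (Track A, DAG node N15 = NE2; FAN-OUT v1.1 §N15 s3 «KING-MODEL RUNG … NE2's analogue DECIDED in the model»)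

HONEST FRAMING.  Count-neutral (cell `pub-ymgap`, seat `pub-ymgap-dag-n15-e` g30; `--supports stmt-QuantumFields-27366 --as helper` = K3⁸
`SpineGivenEndpointR13SepCoPHV`).  TEMPLATE LITERATURE: C. King, *The U(1) Higgs model. I. The continuum limit*, Commun. Math. Phys. **102** (1986) 649–677
[King1986]: the deduction (3.40)–(3.42) p. 660 and Theorem 3.4 (3.9) p. 656 (the shape `C(L^{−γk}…)|T|`), Proposition 3.6 (3.56)–(3.57) p. 662, Proposition 3.8
(3.71) p. 664 — KING's OWN `A = 0` MODEL on the rung's tori (`T^{(K)} = Tor (kingVol L jv)`, `|T^{(K)}| = (2L^{jv.m})^{d+1}`, part Β-a `card_unitTorus`).  NOT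
Bałaban's `G(U)`; NOT a node discharge; nothing continuum ∕ ℝ⁴ ∕ OS ∕ mass-gap ∕ Clay.  0 `sorry`; standard axioms.  Text layer of pp. 656–662
(`paper:king1986-cmp102-king-u1-higgs-i` p0008–p0014) re-read by this seat 2026-08-29.

THE PRINT.  p. 660 [PDF 12] (3.40): *«E^{(k+n)}(H) − E^{(k)}(H) = Σ_{y_1,…,y_s ∈ T^{(k)}} Σ_{z_1,…,z_t} φ^{(k)}(y_1)⋯φ^{(k)}(y_s){E^{(k+n)}(H; {y_i},{z_j}) −
E^{(k)}(H; {y_i},{z_j})}»*; (3.42): *«|E^{(k+n)}(H) − E^{(k)}(H)| ≤ Σ_{y_1∈T^{(k)}} … ≤ C(…)|T|…»*; p. 656 [PDF 8] (3.9): *«… ≤ C(L^{−γk}(L^kε_κ)^{−β} + (L^kε_κ)^σ)|T|»*.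

READING (declared; ours).  A connected graph with `s = r + 1` scalar legs — King's external lines (3.71) to unit sites (parts Η-e∕Α-g: `kingExtLo`∕`kingExtHi`),
a root leg at the vertex `0` and `r ≥ 1` further legs — is paired with ONE unit-lattice field `φ` at every leg (`|φ| ≤ Φ`), as in (3.40).  With the root pinned at
`y₀ ∈ T^{(K)}`, part Α-n §2 (`king_prop36_fieldPoints_extLegs_treeDecay`: the `r` field points summed out with the tree decay of (3.56), rate `L^{−γK}` kept)
bounds the inner sum uniformly in `y₀` and in the volume; the outer sum over `y₀` is «Σ_{y_1∈T^{(k)}} ≤ |T|», the last line of (3.42) ⇒ ★★★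
`|Σ_{y₀} Σ_w φ(y₀)Π_lφ(w_l)·[E^{(K+n)} − E^{(K)}](G; y₀, w)| ≤ |T^{(K)}|·L^{−γK}·(Φ·C^{2m+nn+(1+r)}·m!·(m+r+2))·(Φ(1+4r∕δ)e^{δ∕4r}K_{d+1}(δ∕4r))^r`.  §2: p. 664's
sentence ∕ (3.77) discharged for connected pseudoforests of `G`-lines in `1 ≤ d ≤ 3` (parts Δ-c∕Α-p), so the vacuum forms of part Β-a and the field-paired
form hold there with NO hypothesis.

WHAT THIS FILE PROVES (namespace `Summit.QuantumFields.YangMills.BalabanUVNodes.N15KingModelRung.Curved`).  §1 ★★★ **`king_graph_fields_rate_extensive`**.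
§2 ★★ `king_vacuum_pseudoforest_rate_extensive`, ★★ `king_vacuum_pseudoforest_size_extensive`, ★★ `king_pseudoforest_fields_rate_extensive`.

HONEST SCOPE.  (a) King's `A = 0` model; ONE field `φ` at all scalar legs (King's (3.40) has one scalar field species); the vector-field insertions of (3.55)
are part Α-n's; the vertices' couplings, sources, dressings and §3.5 are not placed, so (3.9)'s `(L^kε_κ)`-bookkeeping and the split (3.41) have no counterpart
(part Β-a HONEST SCOPE (a)).  (b) NOT Bałaban's `G(U)`; N15 untouched; counts unmoved.
Locators: [King1986] Thm 3.4 (3.9) p.656, (3.40)–(3.42) p.660, Prop. 3.6 (3.56)–(3.57) p.662, p.664, Prop. 3.8 (3.71) p.664, (3.77) p.666.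
-/

noncomputable section

open scoped BigOperators
open Finset

namespace Summit.QuantumFields.YangMills.BalabanUVNodes.N15KingModelRung.Curved

open Literature.MathematicalPhysics.QuantumFieldTheory.Balaban1983to89.B4Sect5Proof (latticeConst latticeConst_nonneg)
open Literature.MathematicalPhysics.QuantumFieldTheory.Balaban1983to89.B5Prop11Plancherel (Tor fine)
open Literature.MathematicalPhysics.QuantumFieldTheory.King1986.Torus (tdistT tdistT_nonneg)
open Summit.QuantumFields.YangMills.BalabanUVNodes.N15KingModelRung (KingVolIndex kingVol kingVol_neZero basePt)
open Summit.QuantumFields.YangMills.BalabanUVNodes.N15KingModelRung.Graph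

variable {d : ℕ} (L : ℕ) [NeZero L]

/-! ## §1 Diagrams paired with a bounded unit-lattice field: (3.40) ⇒ (3.42) ⇒ the shape of (3.9) -/

section Fields

/-- ★★★ **(3.40)–(3.42) ⇒ (3.9)'s SHAPE FOR ONE DIAGRAM, BY NAME AT `A = 0`: A DIAGRAM WITH `r + 1` SCALAR LEGS PAIRED WITH A BOUNDED UNIT-LATTICE FIELD CONVERGES
AT THE RATE `L^{−γK}`, EXTENSIVELY.**  For odd `L ≥ 3`, `a > 0`, `m₀² ≥ 0` there are `C ≥ 1`, `γ, δ > 0` such that for every mass `0 < m² ≤ m₀²`, index `jv`,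
`n ≥ 1`, every CONNECTED numbered graph satisfying p. 664's sentence, a root leg of kind `κ₀` at the vertex `0`, `r ≥ 1` further legs (vertices `vtxF`, kinds
`κF`; all legs King's (3.71) kernels to unit sites, parts Η-e∕Α-g) and every unit-lattice field `|φ| ≤ Φ`:
`|Σ_{y₀ ∈ T^{(K)}} Σ_{w ∈ (T^{(K)})^r} φ(y₀)·Π_l φ(w_l)·[E^{(K+n)}(G; y₀, w) − E^{(K)}(G; y₀, w)]|`
`≤ |T^{(K)}|·L^{−γK}·(Φ·C^{2m+nn+(1+r)}·m!·(m + (1+r) + 1))·(Φ(1 + 4r∕δ)e^{δ∕4r}K_{d+1}(δ∕4r))^r` — part Α-n §2 (`king_prop36_fieldPoints_extLegs_treeDecay`,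
the field points summed with the tree decay) at the root pinned to `y₀`, then the sum over `y₀`: «Σ_{y_1} ≤ |T|», the last line of (3.42).
[cite: King1986, (3.40)–(3.42) p.660, Thm 3.4 (3.9) p.656, Prop. 3.6 (3.56)–(3.57) p.662, Prop. 3.8 (3.71) p.664] -/
theorem king_graph_fields_rate_extensive (hLodd : Odd L) (hL : 2 ≤ L) {a : ℝ} (ha : 0 < a) {m0sq : ℝ} (hm0 : 0 ≤ m0sq) :
    ∃ C γ δ : ℝ, 1 ≤ C ∧ 0 < γ ∧ 0 < δ ∧ ∀ (msq : ℝ), 0 < msq → msq ≤ m0sq → ∀ (jv : KingVolIndex d) (n : ℕ), 1 ≤ n →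
      ∀ (nn m : ℕ) (src tgt : Fin m → Fin (nn + 1)), (∀ v, LConn src tgt univ 0 v) →
      ∀ (κ : Fin m → Option (Fin (d + 1))), PosSubgraphsBy src tgt 0 ((d + 1 : ℕ) : ℝ) (fun ℓ => lineExp (d + 1) (κ ℓ)) →
      ∀ (κ₀ : Option (Fin (d + 1))) (r : ℕ), 1 ≤ r → ∀ (vtxF : Fin r → Fin (nn + 1)) (κF : Fin r → Option (Fin (d + 1)))
        (Φ : ℝ), 0 ≤ Φ → ∀ (φ : Tor (kingVol L jv) → ℝ), (∀ y, |φ y| ≤ Φ) →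
        haveI := kingVol_neZero L jv
        |∑ y₀ : Tor (kingVol L jv), ∑ w : Fin r → Tor (kingVol L jv), (φ y₀ * ∏ l, φ (w l))
            * (graphValLS ((((L : ℝ) ^ (jv.K + n))⁻¹) ^ (d + 1)) src tgt (fun ℓ => kingGLine L (kingVol L jv) a msq (jv.K + n) (κ ℓ))
                  (Sum.elim (fun _ : Unit => (0 : Fin (nn + 1))) vtxF)
                  (fun υ => kingExtHi L a msq jv n (Sum.elim (fun _ : Unit => y₀) w υ) (Sum.elim (fun _ : Unit => κ₀) κF υ))
              - graphValLS ((((L : ℝ) ^ jv.K)⁻¹) ^ (d + 1)) src tgt (fun ℓ => kingGLine L (kingVol L jv) a msq jv.K (κ ℓ))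
                  (Sum.elim (fun _ : Unit => (0 : Fin (nn + 1))) vtxF)
                  (fun υ => kingExtLo L a msq jv (Sum.elim (fun _ : Unit => y₀) w υ) (Sum.elim (fun _ : Unit => κ₀) κF υ)))|
          ≤ (Fintype.card (Tor (kingVol L jv)) : ℝ) * (L : ℝ) ^ (-(γ * jv.K))
              * ((Φ * (C ^ (2 * m + nn + (1 + r)) * ((m.factorial : ℝ) * (m + (1 + r) + 1))))
                * (Φ * (1 + 4 * r / δ) * (Real.exp (δ / (4 * r)) * latticeConst (d + 1) (δ / (4 * r)))) ^ r) := by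
  obtain ⟨C, γ, δ, hC, hγ, hδ, H⟩ := king_prop36_fieldPoints_extLegs_treeDecay (d := d) L hLodd hL ha hm0
  refine ⟨C, γ, δ, hC, hγ, hδ, fun msq hm hcap jv n hn nn m src tgt hconn κ hsub κ₀ r hr vtxF κF Φ hΦ φ hφ => ?_⟩
  haveI := kingVol_neZero L jv
  have hL0 : (0 : ℝ) < L := by exact_mod_cast (show 0 < L by omega)
  set θ : ℝ := (L : ℝ) ^ (-(γ * jv.K)) with hθ
  have hθ0 : 0 ≤ θ := Real.rpow_nonneg hL0.le _
  set Z : ℝ := (Φ * (1 + 4 * r / δ) * (Real.exp (δ / (4 * r)) * latticeConst (d + 1) (δ / (4 * r)))) ^ r with hZ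
  have hZ0 : 0 ≤ Z := by
    have := latticeConst_nonneg (d + 1) (div_pos hδ (by positivity : (0 : ℝ) < 4 * r)).le
    positivity
  set B : ℝ := C ^ (2 * m + nn + (1 + r)) * ((m.factorial : ℝ) * (m + (1 + r) + 1)) with hB
  have hB0 : 0 ≤ B := by have := zero_le_one.trans hC; positivity
  -- the root pinned at `y₀`: part Α-n §2 with `Υ = Unit`, `υ₀ = υ₁ = ()`, tree length of one point `= 0`
  have hpin : ∀ y₀ : Tor (kingVol L jv),
      |∑ w : Fin r → Tor (kingVol L jv), (∏ l, φ (w l))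
          * (graphValLS ((((L : ℝ) ^ (jv.K + n))⁻¹) ^ (d + 1)) src tgt (fun ℓ => kingGLine L (kingVol L jv) a msq (jv.K + n) (κ ℓ))
                (Sum.elim (fun _ : Unit => (0 : Fin (nn + 1))) vtxF)
                (fun υ => kingExtHi L a msq jv n (Sum.elim (fun _ : Unit => y₀) w υ) (Sum.elim (fun _ : Unit => κ₀) κF υ))
            - graphValLS ((((L : ℝ) ^ jv.K)⁻¹) ^ (d + 1)) src tgt (fun ℓ => kingGLine L (kingVol L jv) a msq jv.K (κ ℓ))
                (Sum.elim (fun _ : Unit => (0 : Fin (nn + 1))) vtxF)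
                (fun υ => kingExtLo L a msq jv (Sum.elim (fun _ : Unit => y₀) w υ) (Sum.elim (fun _ : Unit => κ₀) κF υ)))|
        ≤ θ * B * Z := by
    intro y₀
    have key := H msq hm hcap jv n hn nn m src tgt hconn κ hsub Unit (fun _ => 0) () rfl (fun _ => y₀) (fun _ => κ₀) () r hr vtxF κF Φ hΦ φ
      (fun w => (hφ w).trans (le_mul_of_one_le_right hΦ (le_add_of_nonneg_right (kingDist_nonneg L jv _ _))))
    have htree : treeLength (kingDist L jv) (anchors fun _ : Unit => some (basePt (L ^ jv.K) (kingVol L jv) y₀)) = 0 := by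
      refine treeLength_of_card_le_one (fun x y => kingDist_nonneg L jv x y) ?_
      refine (card_le_one_iff_subset_singleton.2 ⟨basePt (L ^ jv.K) (kingVol L jv) y₀, fun y hy => ?_⟩)
      obtain ⟨υ, hυ⟩ := (mem_anchors _).1 hy
      exact mem_singleton.2 (Option.some_injective _ hυ.symm)
    rw [Fintype.card_unique, htree, mul_zero, neg_zero, Real.exp_zero, mul_one] at key
    simpa only [hθ, hB, hZ, Nat.cast_one] using key
  -- the sum over the root site
  have hsplit : ∀ y₀ : Tor (kingVol L jv),
      (∑ w : Fin r → Tor (kingVol L jv), (φ y₀ * ∏ l, φ (w l))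
          * (graphValLS ((((L : ℝ) ^ (jv.K + n))⁻¹) ^ (d + 1)) src tgt (fun ℓ => kingGLine L (kingVol L jv) a msq (jv.K + n) (κ ℓ))
                (Sum.elim (fun _ : Unit => (0 : Fin (nn + 1))) vtxF)
                (fun υ => kingExtHi L a msq jv n (Sum.elim (fun _ : Unit => y₀) w υ) (Sum.elim (fun _ : Unit => κ₀) κF υ))
            - graphValLS ((((L : ℝ) ^ jv.K)⁻¹) ^ (d + 1)) src tgt (fun ℓ => kingGLine L (kingVol L jv) a msq jv.K (κ ℓ))
                (Sum.elim (fun _ : Unit => (0 : Fin (nn + 1))) vtxF)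
                (fun υ => kingExtLo L a msq jv (Sum.elim (fun _ : Unit => y₀) w υ) (Sum.elim (fun _ : Unit => κ₀) κF υ))))
        = φ y₀ * ∑ w : Fin r → Tor (kingVol L jv), (∏ l, φ (w l))
          * (graphValLS ((((L : ℝ) ^ (jv.K + n))⁻¹) ^ (d + 1)) src tgt (fun ℓ => kingGLine L (kingVol L jv) a msq (jv.K + n) (κ ℓ))
                (Sum.elim (fun _ : Unit => (0 : Fin (nn + 1))) vtxF)
                (fun υ => kingExtHi L a msq jv n (Sum.elim (fun _ : Unit => y₀) w υ) (Sum.elim (fun _ : Unit => κ₀) κF υ))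
            - graphValLS ((((L : ℝ) ^ jv.K)⁻¹) ^ (d + 1)) src tgt (fun ℓ => kingGLine L (kingVol L jv) a msq jv.K (κ ℓ))
                (Sum.elim (fun _ : Unit => (0 : Fin (nn + 1))) vtxF)
                (fun υ => kingExtLo L a msq jv (Sum.elim (fun _ : Unit => y₀) w υ) (Sum.elim (fun _ : Unit => κ₀) κF υ))) := by
    intro y₀
    rw [mul_sum]
    exact sum_congr rfl fun w _ => by ring
  simp_rw [hsplit]
  refine (abs_sum_le_sum_abs _ _).trans ?_
  have hterm : ∀ y₀ : Tor (kingVol L jv), |φ y₀ * _| ≤ Φ * (θ * B * Z) := fun y₀ => by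
    rw [abs_mul]
    exact mul_le_mul (hφ y₀) (hpin y₀) (abs_nonneg _) hΦ
  refine (sum_le_sum fun y₀ _ => hterm y₀).trans ?_
  rw [sum_const, card_univ, nsmul_eq_mul]
  exact le_of_eq (by ring)

end Fields

/-! ## §2 The hypothesis-free class: connected pseudoforests of `G`-lines, `1 ≤ d ≤ 3` -/

section Pseudoforest

/-- ★★ **VACUUM PSEUDOFORESTS CONVERGE EXTENSIVELY — NO HYPOTHESIS** (`1 ≤ d ≤ 3`; no tadpole, no parallel pair: all connected trees and one-loop graphs of
`G`-lines): `|E^{(K+n)}(G) − E^{(K)}(G)| ≤ |T^{(K)}|·L^{−γK}·A^{2m+nn+1}·m!·(m+1)` (part Β-a §3 with p. 664's sentence discharged by part Δ-c's counting).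
[cite: King1986, Thm 3.4 (3.9) p.656, Prop. 3.6 (3.56) p.662, p.664] -/
theorem king_vacuum_pseudoforest_rate_extensive (hd1 : 1 ≤ d) (hd3 : d ≤ 3) (hLodd : Odd L) (hL : 2 ≤ L) {a : ℝ} (ha : 0 < a)
    {m0sq : ℝ} (hm0 : 0 ≤ m0sq) :
    ∃ A γ : ℝ, 1 ≤ A ∧ 0 < γ ∧ ∀ (msq : ℝ), 0 < msq → msq ≤ m0sq → ∀ (jv : KingVolIndex d) (n : ℕ), 1 ≤ n →
      ∀ (nn m : ℕ) (src tgt : Fin m → Fin (nn + 1)), (∀ v, LConn src tgt univ 0 v) →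
      (∀ ℓ, src ℓ ≠ tgt ℓ) → (∀ S : Finset (Fin m), S.card ≤ (lineVerts src tgt S).card) →
      (∀ S : Finset (Fin m), S.card = 2 → 3 ≤ (lineVerts src tgt S).card) →
        haveI := kingVol_neZero L jv
        |graphValLS ((((L : ℝ) ^ (jv.K + n))⁻¹) ^ (d + 1)) src tgt (fun _ => kingGLine L (kingVol L jv) a msq (jv.K + n) none)
              (fun _ : Unit => (0 : Fin (nn + 1))) (fun _ _ => (1 : ℝ))
            - graphValLS ((((L : ℝ) ^ jv.K)⁻¹) ^ (d + 1)) src tgt (fun _ => kingGLine L (kingVol L jv) a msq jv.K none)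
              (fun _ : Unit => (0 : Fin (nn + 1))) (fun _ _ => (1 : ℝ))|
          ≤ (Fintype.card (Tor (kingVol L jv)) : ℝ) * (L : ℝ) ^ (-(γ * jv.K)) * (A ^ (2 * m + nn + 1) * ((m.factorial : ℝ) * (m + 1))) := by
  obtain ⟨A, γ, hA, hγ, H⟩ := king_vacuum_graph_rate_extensive (d := d) L hLodd hL ha hm0
  refine ⟨A, γ, hA, hγ, fun msq hm hcap jv n hn nn m src tgt hconn h1 h2 h3 => ?_⟩
  exact H msq hm hcap jv n hn nn m src tgt hconn (fun _ => none) (posSubgraphsBy_lineExp_pseudoforest hd1 hd3 h1 h2 h3)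

/-- ★★ **VACUUM PSEUDOFORESTS ARE UV-FINITE AND EXTENSIVE — NO HYPOTHESIS** (`1 ≤ d ≤ 3`): `|E^{(K)}(G)| ≤ |T^{(K)}|·A^{m+nn+1}·(Σ_π degConst)` (part Β-a §3's size
form with (3.77) discharged by part Α-p `posDegrees_kingDegList_pseudoforest`). [cite: King1986, Thm 2.1 (ii) (2.23) p.654, Thm 3.5 (3.38) p.660, (3.77) p.666] -/
theorem king_vacuum_pseudoforest_size_extensive (hd1 : 1 ≤ d) (hd3 : d ≤ 3) (hLodd : Odd L) (hL : 2 ≤ L) {a : ℝ} (ha : 0 < a)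
    {m0sq : ℝ} (hm0 : 0 ≤ m0sq) :
    ∃ A : ℝ, 1 ≤ A ∧ ∀ (msq : ℝ), 0 < msq → msq ≤ m0sq → ∀ (jv : KingVolIndex d)
      (nn m : ℕ) (src tgt : Fin m → Fin (nn + 1)), (∀ v, LConn src tgt univ 0 v) →
      (∀ ℓ, src ℓ ≠ tgt ℓ) → (∀ S : Finset (Fin m), S.card ≤ (lineVerts src tgt S).card) →
      (∀ S : Finset (Fin m), S.card = 2 → 3 ≤ (lineVerts src tgt S).card) →
        haveI := kingVol_neZero L jv
        |graphValLS ((((L : ℝ) ^ jv.K)⁻¹) ^ (d + 1)) src tgt (fun _ => kingGLine L (kingVol L jv) a msq jv.K none)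
              (fun _ : Unit => (0 : Fin (nn + 1))) (fun _ _ => (1 : ℝ))|
          ≤ (Fintype.card (Tor (kingVol L jv)) : ℝ) * (A ^ (m + nn + 1)
              * ∑ π : Equiv.Perm (Fin m), degConst L (kingDegList src tgt ((d + 1 : ℕ) : ℝ)
                  (fun ℓ => lineExp (d + 1) ((fun _ : Fin m => (none : Option (Fin (d + 1)))) ℓ)) π)) := by
  obtain ⟨A, hA, H⟩ := king_vacuum_graph_size_extensive (d := d) L hLodd hL ha hm0
  refine ⟨A, hA, fun msq hm hcap jv nn m src tgt hconn h1 h2 h3 => ?_⟩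
  exact H msq hm hcap jv nn m src tgt hconn (fun _ => none) (posDegrees_kingDegList_pseudoforest hd1 hd3 h1 h2 h3)

/-- ★★ **PSEUDOFORESTS PAIRED WITH A BOUNDED UNIT-LATTICE FIELD CONVERGE EXTENSIVELY — NO HYPOTHESIS** (`1 ≤ d ≤ 3`): §1 with p. 664's sentence discharged.
[cite: King1986, (3.40)–(3.42) p.660, Thm 3.4 (3.9) p.656, Prop. 3.6 (3.56) p.662, p.664] -/
theorem king_pseudoforest_fields_rate_extensive (hd1 : 1 ≤ d) (hd3 : d ≤ 3) (hLodd : Odd L) (hL : 2 ≤ L) {a : ℝ} (ha : 0 < a)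
    {m0sq : ℝ} (hm0 : 0 ≤ m0sq) :
    ∃ C γ δ : ℝ, 1 ≤ C ∧ 0 < γ ∧ 0 < δ ∧ ∀ (msq : ℝ), 0 < msq → msq ≤ m0sq → ∀ (jv : KingVolIndex d) (n : ℕ), 1 ≤ n →
      ∀ (nn m : ℕ) (src tgt : Fin m → Fin (nn + 1)), (∀ v, LConn src tgt univ 0 v) →
      (∀ ℓ, src ℓ ≠ tgt ℓ) → (∀ S : Finset (Fin m), S.card ≤ (lineVerts src tgt S).card) →
      (∀ S : Finset (Fin m), S.card = 2 → 3 ≤ (lineVerts src tgt S).card) →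
      ∀ (κ₀ : Option (Fin (d + 1))) (r : ℕ), 1 ≤ r → ∀ (vtxF : Fin r → Fin (nn + 1)) (κF : Fin r → Option (Fin (d + 1)))
        (Φ : ℝ), 0 ≤ Φ → ∀ (φ : Tor (kingVol L jv) → ℝ), (∀ y, |φ y| ≤ Φ) →
        haveI := kingVol_neZero L jv
        |∑ y₀ : Tor (kingVol L jv), ∑ w : Fin r → Tor (kingVol L jv), (φ y₀ * ∏ l, φ (w l))
            * (graphValLS ((((L : ℝ) ^ (jv.K + n))⁻¹) ^ (d + 1)) src tgt (fun _ => kingGLine L (kingVol L jv) a msq (jv.K + n) none)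
                  (Sum.elim (fun _ : Unit => (0 : Fin (nn + 1))) vtxF)
                  (fun υ => kingExtHi L a msq jv n (Sum.elim (fun _ : Unit => y₀) w υ) (Sum.elim (fun _ : Unit => κ₀) κF υ))
              - graphValLS ((((L : ℝ) ^ jv.K)⁻¹) ^ (d + 1)) src tgt (fun _ => kingGLine L (kingVol L jv) a msq jv.K none)
                  (Sum.elim (fun _ : Unit => (0 : Fin (nn + 1))) vtxF)
                  (fun υ => kingExtLo L a msq jv (Sum.elim (fun _ : Unit => y₀) w υ) (Sum.elim (fun _ : Unit => κ₀) κF υ)))|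
          ≤ (Fintype.card (Tor (kingVol L jv)) : ℝ) * (L : ℝ) ^ (-(γ * jv.K))
              * ((Φ * (C ^ (2 * m + nn + (1 + r)) * ((m.factorial : ℝ) * (m + (1 + r) + 1))))
                * (Φ * (1 + 4 * r / δ) * (Real.exp (δ / (4 * r)) * latticeConst (d + 1) (δ / (4 * r)))) ^ r) := by
  obtain ⟨C, γ, δ, hC, hγ, hδ, H⟩ := king_graph_fields_rate_extensive (d := d) L hLodd hL ha hm0
  refine ⟨C, γ, δ, hC, hγ, hδ, fun msq hm hcap jv n hn nn m src tgt hconn h1 h2 h3 => ?_⟩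
  exact H msq hm hcap jv n hn nn m src tgt hconn (fun _ => none) (posSubgraphsBy_lineExp_pseudoforest hd1 hd3 h1 h2 h3)

end Pseudoforest

end Summit.QuantumFields.YangMills.BalabanUVNodes.N15KingModelRung.Curved

end
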